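import Mathlib
import Summits.ResolutionOfSingularities.ResolutionOfSingularities.Theorems.RadicialJungCleanModelsCleanProp44VertexInsertion
import HarnessLib

/-!
# Route `RadicialJung`, crux `CleanModels` (stmt-ResolutionOfSingularities-15917), line `Sketch` rev 35, stub 6 `stub_cleanProp44` (X44c):
# INSERTION AT A VERTEX — THE UNIT AFTER THE INSERTION IS EXPLICIT

Seat decomp-res-hand-2 g19 (structural hand); sequel of ✓ `…CleanProp44VertexInsertion.lean`.  There the transform at the new point `x'` was presented as
`U · ε^{a_{i₀}} · E^{Σ a}` with `U` SOME unit, and the birth alternative was stated for that `U`.  For the births analysis after an insertion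
(`p ∣ a_{i₀}`, `p ∣ Σ a`; the `δ*`-descent of memo `Sketch-memo-4e-cleanPermissible.md` §2.5, brick (iii) of memo g18 §2 (d)) the unit must be KNOWN:
since the two other sides `c_k` (`k ≠ i₀`) do not pass through `x'`, `σ^♯ c_k = E · ρ_k` with `ρ_k` a UNIT, and then
`σ^♯(V · ∏ c_k^{a_k}) = (σ^♯ V · ∏_{k ≠ i₀} ρ_k^{a_k}) · ε^{a_{i₀}} · E^{Σ a}` on the nose.

* `cleanPermissibleAt_strictTransform_of_vertex_or_birth_explicit` — same setting as ✓ `cleanPermissibleAt_strictTransform_of_vertex_or_birth`, plus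
  ANY choice of `ρ_k` with `σ^♯ c_k = E · ρ_k` (`k ≠ i₀`): the `ρ_k` are units, the transform is
  `(σ^♯ V · ∏_{k ≠ i₀} ρ_k^{a_k}) · ε^{a_{i₀}} · E^{Σ a}`, and the strict transform `N' = (ε, ζ)` is clean-permissible at `x'` unless `p ∣ a_{i₀}`, `p ∣ Σ a`
  and THIS unit fails the non-birth test (units presenting the same representative against the same monomial coincide — `𝒪_{X',x'}` is a domain).
* `exists_units_of_vertexInsertion` — such `ρ_k` exist.

Honest framing: OURS, bookkeeping.  Nothing here proves X44c, any case of `CleanModels`, or resolution of singularities in characteristic `p`.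
Setting only: [cite: CossartPiltant2008, Lemma 4.3 (5); Prop. 4.4 (proof, p. 11)] [cite: Piltant2013, §2 Axiom 4].
-/

noncomputable section

set_option linter.dupNamespace false -- mandated namespace of this single-conjunct summit

open IsLocalRing CategoryTheory AlgebraicGeometry
open Literature.AlgebraicGeometry.Resolution Literature.AlgebraicGeometry.Motives

namespace Summit.ResolutionOfSingularities.ResolutionOfSingularities.Theorems.RadicialJung.CleanModels

universe u

section Scheme

variable {p : ℕ} {X X' : Scheme.{u}} [IsIntegral X] [IsIntegral X'] {σ : X' ⟶ X} [IsDominant σ] {J : X.IdealSheafData}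

omit [IsIntegral X] [IsIntegral X'] [IsDominant σ] in
/-- **The sides that leave are unit multiples of the exceptional parameter**: if `(σ^♯ c_k) = 𝔪_x 𝒪_{X',x'} = (E)` for `k ≠ i₀`, there are `ρ_k` with
`σ^♯ c_k = E · ρ_k`. [folklore] -/
theorem exists_units_of_vertexInsertion (x' : X') (c : Fin 3 → X.presheaf.stalk (σ x')) (i₀ : Fin 3) {E : X'.presheaf.stalk x'}
    (hE : Ideal.span {E} = (maximalIdeal (X.presheaf.stalk (σ x'))).map (σ.stalkMap x').hom)
    (hpass : ∀ k, k ≠ i₀ → Ideal.span {(σ.stalkMap x').hom (c k)} = (maximalIdeal (X.presheaf.stalk (σ x'))).map (σ.stalkMap x').hom) :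
    ∃ ρ : Fin 3 → X'.presheaf.stalk x', ∀ k, k ≠ i₀ → (σ.stalkMap x').hom (c k) = E * ρ k := by
  classical
  have key : ∀ k, k ≠ i₀ → ∃ r : X'.presheaf.stalk x', (σ.stalkMap x').hom (c k) = E * r := by
    intro k hk
    have h1 : (σ.stalkMap x').hom (c k) ∈ Ideal.span {E} := by
      rw [hE, ← hpass k hk]; exact Ideal.mem_span_singleton_self _
    obtain ⟨r, hr⟩ := Ideal.mem_span_singleton'.mp h1
    exact ⟨r, by rw [← hr, mul_comm]⟩
  refine ⟨fun k => if hk : k ≠ i₀ then (key k hk).choose else 0, fun k hk => ?_⟩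
  simp only [hk, ne_eq, not_false_eq_true, dif_pos]
  exact (key k hk).choose_spec

set_option maxHeartbeats 1600000 in
-- comparison of two presentations of the transform
/-- **INSERTION AT A VERTEX WITH THE EXPLICIT UNIT.**  See the module docstring. [cite: CossartPiltant2008, Lemma 4.3 (5); Prop. 4.4 (proof, p. 11)]
[cite: Piltant2013, §2 Axiom 4] -/
theorem cleanPermissibleAt_strictTransform_of_vertex_or_birth_explicit [Fact p.Prime] [CharP X'.functionField p] (hσ : IsBlowup σ J)
    (x' : X') (hR : IsRegularLocalRing (X.presheaf.stalk (σ x'))) (c : Fin 3 → X.presheaf.stalk (σ x'))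
    (hc : Ideal.span (Set.range c) = maximalIdeal (X.presheaf.stalk (σ x')))
    (hdim : ringKrullDim (X.presheaf.stalk (σ x')) = (3 : ℕ)) (hJ : stalkIdeal J (σ x') = maximalIdeal (X.presheaf.stalk (σ x')))
    {G : X.functionField} {cc : Fin p → X.functionField} (hcc : ∃ j : Fin p, (j : ℕ) ≠ 0 ∧ cc j ≠ 0)
    {V : X.presheaf.stalk (σ x')} (hV : IsUnit V) (a : Fin 3 → ℕ)
    (hrep : (∑ j : Fin p, cc j ^ p * G ^ (j : ℕ)) = RatFn.toFunctionField (σ x') (V * ∏ k, c k ^ a k))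
    (i₀ : Fin 3) {z : X.presheaf.stalk (σ x')}
    (hz : ∀ k, k ≠ i₀ → Ideal.span ({z, c k, c i₀} : Set (X.presheaf.stalk (σ x'))) = maximalIdeal (X.presheaf.stalk (σ x')))
    (hdim' : ringKrullDim (X'.presheaf.stalk x') = 3) {E ε ζ : X'.presheaf.stalk x'}
    (hE : Ideal.span {E} = (maximalIdeal (X.presheaf.stalk (σ x'))).map (σ.stalkMap x').hom)
    (hε : (σ.stalkMap x').hom (c i₀) = E * ε) (hεm : ε ∈ maximalIdeal (X'.presheaf.stalk x'))
    (hζ : (σ.stalkMap x').hom z = E * ζ) (hζm : ζ ∈ maximalIdeal (X'.presheaf.stalk x'))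
    {ρ : Fin 3 → X'.presheaf.stalk x'} (hρ : ∀ k, k ≠ i₀ → (σ.stalkMap x').hom (c k) = E * ρ k) :
    (∀ k, k ≠ i₀ → IsUnit (ρ k)) ∧
    (∑ j : Fin p, RatFn.functionFieldMap σ (cc j) ^ p * RatFn.functionFieldMap σ G ^ (j : ℕ)) =
      RatFn.toFunctionField x' (((σ.stalkMap x').hom V * ∏ k ∈ Finset.univ.erase i₀, ρ k ^ a k) * ε ^ a i₀ * E ^ (∑ k, a k)) ∧
    (CleanPermissibleAt p (RatFn.toFunctionField x') (RatFn.functionFieldMap σ G) (Ideal.span ({ε, ζ} : Set (X'.presheaf.stalk x'))) ∨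
      (p ∣ a i₀ ∧ p ∣ ∑ k, a k ∧
        ¬ ((∀ c' : X'.presheaf.stalk x', (σ.stalkMap x').hom V * (∏ k ∈ Finset.univ.erase i₀, ρ k ^ a k) - c' ^ p ∉
              maximalIdeal (X'.presheaf.stalk x')) ∨
          (∃ c' : X'.presheaf.stalk x', (σ.stalkMap x').hom V * (∏ k ∈ Finset.univ.erase i₀, ρ k ^ a k) - c' ^ p ∈
              maximalIdeal (X'.presheaf.stalk x') ∧
            (σ.stalkMap x').hom V * (∏ k ∈ Finset.univ.erase i₀, ρ k ^ a k) - c' ^ p ∉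
              Ideal.span ({ε, ζ} : Set (X'.presheaf.stalk x')) ⊔ maximalIdeal (X'.presheaf.stalk x') ^ 2) ∨
          (∃ c' : X'.presheaf.stalk x', (σ.stalkMap x').hom V * (∏ k ∈ Finset.univ.erase i₀, ρ k ^ a k) - c' ^ p ∈
              Ideal.span ({ε, ζ} : Set (X'.presheaf.stalk x')) ∧
            (σ.stalkMap x').hom V * (∏ k ∈ Finset.univ.erase i₀, ρ k ^ a k) - c' ^ p ∉ maximalIdeal (X'.presheaf.stalk x') ^ 2)))) := by
  classical
  obtain ⟨htriple, hpass, U, -, hrepU, hdisj⟩ :=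
    cleanPermissibleAt_strictTransform_of_vertex_or_birth hσ x' hR c hc hdim hJ hcc hV a hrep i₀ hz hdim' hE hε hεm hζ hζm
  -- `𝒪_{X',x'}` is a regular local ring, hence a domain
  have hdim0 : ringKrullDim (X.presheaf.stalk (σ x')) = ((3 + 0 : ℕ) : WithBot ℕ∞) := by rw [Nat.add_zero]; exact hdim
  have hz0 : Ideal.span (Set.range (Fin.append c Fin.elim0)) = maximalIdeal (X.presheaf.stalk (σ x')) := by
    rw [span_range_append_elim0_eq, hc]
  obtain ⟨_, _, _, _, -, -, -, -, -, hrsop, -⟩ :=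
    exists_transform_normalForm_of_isBlowup hσ x' hR c Fin.elim0 hz0 hdim0 (hc.trans hJ.symm) a Fin.elim0 hV
  have hR' : IsRegularLocalRing (X'.presheaf.stalk x') := hrsop.isRegularLocalRing
  haveI := isDomain_of_isRegularLocalRing (X'.presheaf.stalk x')
  have h3 := isRsopPart_vecCons_three_of_span_triple hR' hdim' htriple
  have hE0 : E ≠ 0 := by simpa using h3.ne_zero 0
  have hε0 : ε ≠ 0 := by simpa using h3.ne_zero 1
  -- the `ρ_k` are units
  have hρu : ∀ k, k ≠ i₀ → IsUnit (ρ k) := by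
    intro k hk
    have h1 := hpass k hk
    rw [hρ k hk, ← hE] at h1
    exact isUnit_of_span_singleton_mul_eq hE0 h1
  -- the transform computed directly
  obtain ⟨-, hrep'⟩ := rep_functionFieldMap x' hcc hrep
  have hprod : (σ.stalkMap x').hom (V * ∏ k, c k ^ a k) =
      ((σ.stalkMap x').hom V * ∏ k ∈ Finset.univ.erase i₀, ρ k ^ a k) * ε ^ a i₀ * E ^ (∑ k, a k) := by
    rw [map_mul, map_prod]
    simp only [map_pow]
    rw [← Finset.prod_erase_mul _ _ (Finset.mem_univ i₀), hε]
    have h1 : ∏ k ∈ Finset.univ.erase i₀, (σ.stalkMap x').hom (c k) ^ a k = ∏ k ∈ Finset.univ.erase i₀, (E ^ a k * ρ k ^ a k) := by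
      refine Finset.prod_congr rfl fun k hk => ?_
      rw [hρ k (Finset.ne_of_mem_erase hk), mul_pow]
    rw [h1, Finset.prod_mul_distrib, Finset.prod_pow_eq_pow_sum, ← Finset.sum_erase_add _ _ (Finset.mem_univ i₀), pow_add, mul_pow]
    ring
  rw [hprod] at hrep'
  -- the two units coincide
  have hUeq : U = (σ.stalkMap x').hom V * ∏ k ∈ Finset.univ.erase i₀, ρ k ^ a k := by
    have h2 := RatFn.toFunctionField_injective x' (hrepU.symm.trans hrep')
    have h4 := mul_right_cancel₀ (pow_ne_zero _ hE0) h2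
    exact mul_right_cancel₀ (pow_ne_zero _ hε0) h4
  refine ⟨hρu, hrep', ?_⟩
  rw [hUeq] at hdisj
  exact hdisj

end Scheme

end Summit.ResolutionOfSingularities.ResolutionOfSingularities.Theorems.RadicialJung.CleanModels

end
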